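import Summits.QuantumFields.BalabanUV.Beta.GAN24.MemberOneZeroModeLevelZero
import Summits.QuantumFields.BalabanUV.Beta.GAN24.WilsonQuarticChargeWsym22
import Summits.QuantumFields.BalabanUV.Beta.GAN24.RowCChargeForms

/-!
# `BalabanUV.Beta.GAN24.RowCLevelZero` — binder row G-an2-4 ∕ (CONV-C), the (α-0) chain (`OneCovRecStep`): LOCATED ROW (C) HOLDS AT LEVEL `0` FOR THE
# LITERAL PINS — at `cE² = cE₂ = Lc^{d+5}` and the literal Wilson table `Tc = (8M²)⁻¹ • wsym22 M`, the dressed comb's first step CONSERVES the field–field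
# zero mode on EVERY pattern: `zmode Lc T̃_1 μ ν (inl α) (inl β) = zmode Lc T̃_0 μ ν (inl α) (inl β)`; hence (C)_0 of record (leaf-01's B-frame source form)

NOT IN PRINT; OUR BOOKKEEPING (G-an2-4 formalisation swarm, leaf seat `b2b-balaban-gan24-formalise-leaf-04`, gen 67, journal [LEAF04-G67-INTENT44]; composition
BY NAME of gen 67 file 41 `MemberOneZeroModeLevelZero.zmode_member_one_eq_closed` (member `1` in closed form — the (L3c) cancellation `RespWordsLevelZero` inside),
leaf-02 g63 `WilsonQuarticChargeWsym22.zmode_memberZero_wsym22 ∕ zmode_wilsonW₂_smul ∕ zmode_wilsonW₂_wsym22 ∕ chargePoly_swap` (member `0` and the full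
charge tensor of `wsym22`), and leaf-01 g73 `RowCChargeForms.zsymMember_succ_eq_iff_rowC` (the row's letter ⟺ symmetrised conservation); module name
PROVISIONAL).  HONEST FRAMING (cell contract, verbatim): «discharging `BetaPertH` makes Bałaban's UV stability UNCONDITIONAL — a real constructive-QFT result; it
is NOT the continuum limit and NOT the Clay problem.»  HONEST DEPENDENCY (verbatim): «continuum YM on T⁴ ⇐ BetaPertH ∧ nine spine estimates (0/9 proved);
BetaPertH ⇐ (D1) ∧ (D4) ∧ CAP+tail; G-an2-4 gates asym, D1 and NE2/3/4.»  ABSOLUTE RULE (cell, verbatim): «No internally-minted statement may enter as a cited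
fact. Every hypothesis is either kernel-proved in this package or a verbatim quotation of a PUBLISHED theorem with page reference. The manuscript(s) under audit
are NOT citable for their own disputed steps — they are the thing under adjudication; programme-internal (2001/route/tribunal) claims are never citable.»
0 `def`, 0 `def … : Prop`, 0 cite, 0 sorry; no existing file touched.

WHAT (generic `1 ≤ d`, `1 ≤ Lc`, in-block root `r`, `M ≠ 0`; border `vh₂S` with no ff ∕ mm legs, exponentially localised, block-covariant — K-P's `vh₂SAn1` has
all four; an1's TRUE mixed table `mixFFAt (toSite r) Lc`; pins `cE² = Lc^{d+5}`, `cE₂ = Lc^{d+5}` — the D1 literal `RowD1JointEnd.JsRowD1` at `d = 3` has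
`cE = Lc⁴`, `cE₂ = Lc⁸`, `Tc = (8N²)⁻¹ • wsym22 N`):
* `pins_identity` — the power bookkeeping («9 − 8 = 1» of leaf-04 g64's engine anatomy): the EE exchange number `cE²(Lc²−1)Lc⁻⁴` exactly makes up for the
  `(Lc⁻² − 1)`-aliasing deficit of the contact charge;
* **`zmode_member_one_eq_member_zero`** — `zmode Lc T̃_1 μ ν (inl α) (inl β) = zmode Lc T̃_0 μ ν (inl α) (inl β)` for ALL `μ ν α β` (both
  `= −½·cE₂·Lc^{d+1}·(2[μ=ν][α=β] − [μ=β][ν=α] − [μ=α][ν=β])`);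
* **`zmodeSym_member_one_eq_member_zero`** — the slot-symmetrised form;
* **`rowC_level_zero`** — (C)_0 OF RECORD: the B-frame source `T̃_1 − 𝒜^B_0 T̃_0` has vanishing symmetrised field–field zero mode on every pattern
  (`RowCChargeForms.zsymMember_succ_eq_iff_rowC` at `l = 0`, right to left).

HONEST: PROVES the level-0 instance of located row (C) at the literal pins for an1's DEFINED tables — ONE level of ONE located row; NOT (C) at `j ≥ 1` (there
the mixed words `S₂W₂` ∕ `mixFF` charges and the running units enter: rows (Q-D) ∕ (Q-D-rate)), NOTHING of «T2Shape» ∕ «T2Drift» ∕ (hW, hWall) ∕ D1Tel ∕ D1Rep;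
NEVER «G-an2-4 closed» as (CONV-C); NOT D1, NOT `BetaPertH`, NOT continuum, NOT Clay.  2026-08-23.
-/

noncomputable section

open Finset
open scoped BigOperators
open Literature.MathematicalPhysics.QuantumFieldTheory
open Literature.MathematicalPhysics.QuantumFieldTheory.Balaban1983to89
open Literature.MathematicalPhysics.QuantumFieldTheory.Balaban1983to89.Beta
open AffineAveraging (Site box toSite)
open ExpKernelCalculus (MKer shiftK)
open OneStepResolventKernel (Fib)
open OneStepKernelFamily (KInvStep)
open BalabanCompositeJets (LocStencil₂)
open WilsonVertex2Sym (wsym22)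
open WilsonBiStencil (wilsonW₂)
open AveragingMixedJetTables (mixFFAt)
open Summit.QuantumFields.BalabanUV.Beta.HessKerDressedUnits (unitK)
open Summit.QuantumFields.BalabanUV.Beta.SecondOrderUnits (unitS₂)
open Summit.QuantumFields.BalabanUV.Beta.SpineRooted (T2RecAt)
open Summit.QuantumFields.BalabanUV.Beta.GAN24.CombesThomas (sfStep smStep)
open Summit.QuantumFields.BalabanUV.Beta.GAN24.T2RecursionAffine (lin4)
open Summit.QuantumFields.BalabanUV.Beta.GAN24.BiStencilZeroMode (Tab zmode)
open Summit.QuantumFields.BalabanUV.Beta.GAN24.WilsonBiStencilCornerSupport (boxSums_smul boxSums_wsym22)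
open Summit.QuantumFields.BalabanUV.Beta.GAN24.MemberOneZeroModeLevelZero (zmode_member_one_eq_closed)
open Summit.QuantumFields.BalabanUV.Beta.GAN24.WilsonQuarticChargeWsym22 (zmode_memberZero_wsym22 zmode_wilsonW₂_smul zmode_wilsonW₂_wsym22 chargePoly_swap)
open Summit.QuantumFields.BalabanUV.Beta.GAN24.RowCChargeForms (zsymMember_succ_eq_iff_rowC)

namespace Summit.QuantumFields.BalabanUV.Beta.GAN24.RowCLevelZero

variable {d : ℕ} {Lc : ℕ} [NeZero Lc] {r : Fin (d + 1) → ℕ}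

omit [NeZero Lc] in
/-- [folklore] The power bookkeeping of the charged classes: at `cE² = cE₂ = Lc^{d+5}`, `1 ≤ d`, `Lc ≠ 0`, whenever `e·(Lc² − 1) + 2z·Lc² = 2z`,
`½·cE₂·cE²·(Lc²−1)·(Lc⁴)⁻¹·e + ½·cE₂²·Lc²·(Lc^{d−1}·Lc⁶)⁻¹·(Lc^{d+1}·z + Lc^{d+1}·z) = cE₂·(Lc^{d+1}·z)`. -/
theorem pins_identity (hd : 1 ≤ d) (hL : (Lc : ℝ) ≠ 0) {cE cE₂ : ℝ} (hcE : cE ^ 2 = (Lc : ℝ) ^ (d + 5)) (hcE₂ : cE₂ = (Lc : ℝ) ^ (d + 5))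
    {e z : ℝ} (hez : e * ((Lc : ℝ) ^ 2 - 1) + 2 * z * (Lc : ℝ) ^ 2 = 2 * z) :
    (1 / 2 : ℝ) * cE₂ * cE ^ 2 * ((Lc : ℝ) ^ 2 - 1) * ((Lc : ℝ) ^ 4)⁻¹ * e +
        (1 / 2 : ℝ) * cE₂ ^ 2 * (Lc : ℝ) ^ 2 * ((Lc : ℝ) ^ (d - 1) * (Lc : ℝ) ^ 6)⁻¹ *
          ((Lc : ℝ) ^ (d + 1) * z + (Lc : ℝ) ^ (d + 1) * z) = cE₂ * ((Lc : ℝ) ^ (d + 1) * z) := by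
  rw [hcE, hcE₂]
  have hP1 : (Lc : ℝ) ^ (d + 5) = (Lc : ℝ) ^ (d - 1) * (Lc : ℝ) ^ 6 := by rw [← pow_add]; congr 1; omega
  have hP2 : (Lc : ℝ) ^ (d + 1) = (Lc : ℝ) ^ (d - 1) * (Lc : ℝ) ^ 2 := by rw [← pow_add]; congr 1; omega
  rw [hP1, hP2]
  have hP : (Lc : ℝ) ^ (d - 1) ≠ 0 := pow_ne_zero _ hL
  field_simp
  linear_combination hez

/-- NOT IN PRINT; OUR BOOKKEEPING.  **(C)_0 AT THE LITERAL PINS, EVERY PATTERN**: the dressed comb's first step conserves the field–field zero mode,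
`zmode Lc T̃_1 μ ν (inl α) (inl β) = zmode Lc T̃_0 μ ν (inl α) (inl β)`. -/
theorem zmode_member_one_eq_member_zero (hd : 1 ≤ d) (hLc : 1 ≤ Lc) (hr : r ∈ box (d + 1) Lc) {M : ℕ} (hM : M ≠ 0) (cE cVH cΛ cE₂ cB : ℝ)
    (hcE : cE ^ 2 = (Lc : ℝ) ^ (d + 5)) (hcE₂ : cE₂ = (Lc : ℝ) ^ (d + 5))
    {vh₂S : Tab d} (hBff : ∀ κ u κ' u' x z (α β : Fin (d + 1)), vh₂S κ u κ' u' x z (Sum.inl α) (Sum.inl β) = 0)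
    (hBmm : ∀ κ u κ' u' x z (μ ν : Fin (d + 1)), vh₂S κ u κ' u' x z (Sum.inr μ) (Sum.inr ν) = 0)
    (hB : ∃ C δ : ℝ, 0 < δ ∧ LocStencil₂ vh₂S C δ)
    (hBt : ∀ (κ : Fin (d + 1)) (u : Fin (d + 1) → ℤ) (κ' : Fin (d + 1)) (u' t : Fin (d + 1) → ℤ),
      vh₂S κ (u + (Lc : ℤ) • t) κ' (u' + (Lc : ℤ) • t) = shiftK (-((Lc : ℤ) • t)) (vh₂S κ u κ' u'))
    (μ ν α β : Fin (d + 1)) :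
    zmode Lc (unitS₂ (sfStep Lc (0 + 1)) (smStep d Lc (0 + 1))
        (T2RecAt d Lc (toSite r) cE cVH cΛ cE₂ cB ((8 * (M : ℝ) ^ 2)⁻¹ • wsym22 M) vh₂S (mixFFAt (toSite r) Lc) (0 + 1))) μ ν (Sum.inl α) (Sum.inl β)
      = zmode Lc (unitS₂ (sfStep Lc 0) (smStep d Lc 0)
        (T2RecAt d Lc (toSite r) cE cVH cΛ cE₂ cB ((8 * (M : ℝ) ^ 2)⁻¹ • wsym22 M) vh₂S (mixFFAt (toSite r) Lc) 0)) μ ν (Sum.inl α) (Sum.inl β) := by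
  rw [zmode_member_one_eq_closed hd hLc hr cE cVH cΛ cE₂ cB ((8 * (M : ℝ) ^ 2)⁻¹ • wsym22 M)
      (fun i j k l => boxSums_smul (fun i j k l => boxSums_wsym22 M i j k l) _ i j k l) hBff hBmm hB hBt μ ν α β,
    zmode_memberZero_wsym22 Lc cE cVH cΛ cE₂ cB ((8 * (M : ℝ) ^ 2)⁻¹) M (toSite r) hBff μ ν α β,
    zmode_wilsonW₂_smul Lc _ _ μ ν, zmode_wilsonW₂_smul Lc _ _ ν μ, zmode_wilsonW₂_wsym22 Lc M μ ν α β, zmode_wilsonW₂_wsym22 Lc M ν μ α β,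
    chargePoly_swap M μ ν α β]
  have hL : (Lc : ℝ) ≠ 0 := by exact_mod_cast (show Lc ≠ 0 by omega)
  have hM' : (M : ℝ) ≠ 0 := by exact_mod_cast hM
  have hc : (8 * (M : ℝ) ^ 2)⁻¹ * (-4 * (M : ℝ) ^ 2) = -(1 / 2 : ℝ) := by field_simp; ring
  by_cases h1 : μ = ν
  · subst h1
    by_cases h2 : α = β
    · subst h2
      by_cases h3 : μ = α
      · subst h3
        simp only [and_self, if_true]
        linear_combination (0 : ℝ) * hc
      · -- diagonal class `(μ, μ; α, α)`: `#S = 2`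
        have hS : ({μ, μ, α, α} : Finset (Fin (d + 1))).card = 2 := by
          rw [show ({μ, μ, α, α} : Finset (Fin (d + 1))) = {μ, α} by
            ext x; simp only [Finset.mem_insert, Finset.mem_singleton]; tauto]
          exact Finset.card_pair h3
        simp only [and_self, if_true, h3, Ne.symm h3, if_false, sub_zero, hS, Nat.reduceSub]
        have := pins_identity hd hL hcE hcE₂ (e := 2) (z := -1) (by ring)
        linear_combination this + (cE₂ ^ 2 * (Lc : ℝ) ^ 2 * ((Lc : ℝ) ^ (d - 1) * (Lc : ℝ) ^ 6)⁻¹ * (Lc : ℝ) ^ (d + 1) * 2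
          - cE₂ * (Lc : ℝ) ^ (d + 1) * 2) * hc
    · by_cases h3 : μ = α
      · subst h3
        simp only [and_true, h2, if_false, and_false]
        linear_combination (0 : ℝ) * hc
      · by_cases h4 : μ = β
        · subst h4
          simp only [and_true, h3, Ne.symm h3, if_false, and_false]
          linear_combination (0 : ℝ) * hc
        · simp only [h2, h3, h4, Ne.symm h3, if_false, and_false]
          linear_combination (0 : ℝ) * hc
  · by_cases h2 : α = β
    · subst h2
      by_cases h3 : α = μ
      · subst h3
        simp only [and_true, h1, Ne.symm h1, if_false, and_false]
        linear_combination (0 : ℝ) * hc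
      · by_cases h4 : α = ν
        · subst h4
          simp only [and_true, h1, Ne.symm h1, if_false, and_false]
          linear_combination (0 : ℝ) * hc
        · simp only [and_true, h1, Ne.symm h1, h3, Ne.symm h3, h4, Ne.symm h4, if_false, and_false]
          linear_combination (0 : ℝ) * hc
    · by_cases h3 : α = μ
      · subst h3
        by_cases h4 : β = ν
        · subst h4
          -- parallel class `(α, β; α, β)`: `#S = 2`
          have hS : ({α, β, α, β} : Finset (Fin (d + 1))).card = 2 := by
            rw [show ({α, β, α, β} : Finset (Fin (d + 1))) = {α, β} by
              ext x; simp only [Finset.mem_insert, Finset.mem_singleton]; tauto]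
            exact Finset.card_pair h1
          simp only [h1, Ne.symm h1, if_false, and_self, if_true, sub_zero, zero_sub, hS, Nat.reduceSub]
          have := pins_identity hd hL hcE hcE₂ (e := -1) (z := 1 / 2) (by ring)
          linear_combination this + (-(cE₂ ^ 2 * (Lc : ℝ) ^ 2 * ((Lc : ℝ) ^ (d - 1) * (Lc : ℝ) ^ 6)⁻¹ * (Lc : ℝ) ^ (d + 1))
            + cE₂ * (Lc : ℝ) ^ (d + 1)) * hc
        · simp only [h1, Ne.symm h1, h2, Ne.symm h4, and_false, if_false, and_true]
          linear_combination (0 : ℝ) * hc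
      · by_cases h4 : α = ν
        · subst h4
          by_cases h5 : β = μ
          · subst h5
            -- crossed class `(β, α; α, β)`: `#S = 2`
            have hS : ({β, α, α, β} : Finset (Fin (d + 1))).card = 2 := by
              rw [show ({β, α, α, β} : Finset (Fin (d + 1))) = {α, β} by
                ext x; simp only [Finset.mem_insert, Finset.mem_singleton]; tauto]
              exact Finset.card_pair h2
            simp only [h1, Ne.symm h1, if_false, and_self, if_true, sub_zero, zero_sub, hS, Nat.reduceSub]
            have := pins_identity hd hL hcE hcE₂ (e := -1) (z := 1 / 2) (by ring)
            linear_combination this + (-(cE₂ ^ 2 * (Lc : ℝ) ^ 2 * ((Lc : ℝ) ^ (d - 1) * (Lc : ℝ) ^ 6)⁻¹ * (Lc : ℝ) ^ (d + 1))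
              + cE₂ * (Lc : ℝ) ^ (d + 1)) * hc
          · simp only [h1, Ne.symm h1, h2, Ne.symm h5, and_false, if_false, and_true]
            linear_combination (0 : ℝ) * hc
        · simp only [h1, Ne.symm h1, h3, Ne.symm h3, h4, Ne.symm h4, false_and, and_false, if_false]
          linear_combination (0 : ℝ) * hc

/-- NOT IN PRINT; OUR BOOKKEEPING.  **(C)sym AT LEVEL 0, EVERY PATTERN** — the slot-symmetrised field–field zero mode is conserved by the first step. -/
theorem zmodeSym_member_one_eq_member_zero (hd : 1 ≤ d) (hLc : 1 ≤ Lc) (hr : r ∈ box (d + 1) Lc) {M : ℕ} (hM : M ≠ 0) (cE cVH cΛ cE₂ cB : ℝ)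
    (hcE : cE ^ 2 = (Lc : ℝ) ^ (d + 5)) (hcE₂ : cE₂ = (Lc : ℝ) ^ (d + 5))
    {vh₂S : Tab d} (hBff : ∀ κ u κ' u' x z (α β : Fin (d + 1)), vh₂S κ u κ' u' x z (Sum.inl α) (Sum.inl β) = 0)
    (hBmm : ∀ κ u κ' u' x z (μ ν : Fin (d + 1)), vh₂S κ u κ' u' x z (Sum.inr μ) (Sum.inr ν) = 0)
    (hB : ∃ C δ : ℝ, 0 < δ ∧ LocStencil₂ vh₂S C δ)
    (hBt : ∀ (κ : Fin (d + 1)) (u : Fin (d + 1) → ℤ) (κ' : Fin (d + 1)) (u' t : Fin (d + 1) → ℤ),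
      vh₂S κ (u + (Lc : ℤ) • t) κ' (u' + (Lc : ℤ) • t) = shiftK (-((Lc : ℤ) • t)) (vh₂S κ u κ' u'))
    (κ κ' κ₁ κ₂ : Fin (d + 1)) :
    zmode Lc (unitS₂ (sfStep Lc (0 + 1)) (smStep d Lc (0 + 1))
          (T2RecAt d Lc (toSite r) cE cVH cΛ cE₂ cB ((8 * (M : ℝ) ^ 2)⁻¹ • wsym22 M) vh₂S (mixFFAt (toSite r) Lc) (0 + 1))) κ κ' (Sum.inl κ₁) (Sum.inl κ₂)
      + zmode Lc (unitS₂ (sfStep Lc (0 + 1)) (smStep d Lc (0 + 1))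
          (T2RecAt d Lc (toSite r) cE cVH cΛ cE₂ cB ((8 * (M : ℝ) ^ 2)⁻¹ • wsym22 M) vh₂S (mixFFAt (toSite r) Lc) (0 + 1))) κ' κ (Sum.inl κ₁) (Sum.inl κ₂)
      = zmode Lc (unitS₂ (sfStep Lc 0) (smStep d Lc 0)
          (T2RecAt d Lc (toSite r) cE cVH cΛ cE₂ cB ((8 * (M : ℝ) ^ 2)⁻¹ • wsym22 M) vh₂S (mixFFAt (toSite r) Lc) 0)) κ κ' (Sum.inl κ₁) (Sum.inl κ₂)
      + zmode Lc (unitS₂ (sfStep Lc 0) (smStep d Lc 0)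
          (T2RecAt d Lc (toSite r) cE cVH cΛ cE₂ cB ((8 * (M : ℝ) ^ 2)⁻¹ • wsym22 M) vh₂S (mixFFAt (toSite r) Lc) 0)) κ' κ (Sum.inl κ₁) (Sum.inl κ₂) := by
  rw [zmode_member_one_eq_member_zero hd hLc hr hM cE cVH cΛ cE₂ cB hcE hcE₂ hBff hBmm hB hBt κ κ' κ₁ κ₂,
    zmode_member_one_eq_member_zero hd hLc hr hM cE cVH cΛ cE₂ cB hcE hcE₂ hBff hBmm hB hBt κ' κ κ₁ κ₂]

/-- NOT IN PRINT; OUR BOOKKEEPING.  **LOCATED ROW (C) AT LEVEL `0` — OF RECORD — FOR THE LITERAL PINS**: the B-frame source of the first step,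
`T̃_1 − lin4 (cE₂·Lc^{2(d+1)}) K♮_0 Lc T̃_0`, has vanishing slot-symmetrised field–field zero mode on every pattern
(`RowCChargeForms.zsymMember_succ_eq_iff_rowC` at `l = 0`, from `zmodeSym_member_one_eq_member_zero`). -/
theorem rowC_level_zero (hd : 1 ≤ d) (hLc : 1 ≤ Lc) (hr : r ∈ box (d + 1) Lc) {M : ℕ} (hM : M ≠ 0) (cE cVH cΛ cE₂ cB : ℝ)
    (hcE : cE ^ 2 = (Lc : ℝ) ^ (d + 5)) (hcE₂ : cE₂ = (Lc : ℝ) ^ (d + 5))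
    {vh₂S : Tab d} (hBff : ∀ κ u κ' u' x z (α β : Fin (d + 1)), vh₂S κ u κ' u' x z (Sum.inl α) (Sum.inl β) = 0)
    (hBmm : ∀ κ u κ' u' x z (μ ν : Fin (d + 1)), vh₂S κ u κ' u' x z (Sum.inr μ) (Sum.inr ν) = 0)
    (hB : ∃ C δ : ℝ, 0 < δ ∧ LocStencil₂ vh₂S C δ)
    (hBt : ∀ (κ : Fin (d + 1)) (u : Fin (d + 1) → ℤ) (κ' : Fin (d + 1)) (u' t : Fin (d + 1) → ℤ),
      vh₂S κ (u + (Lc : ℤ) • t) κ' (u' + (Lc : ℤ) • t) = shiftK (-((Lc : ℤ) • t)) (vh₂S κ u κ' u'))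
    (κ κ' κ₁ κ₂ : Fin (d + 1)) :
    zmode Lc ((unitS₂ (sfStep Lc (0 + 1)) (smStep d Lc (0 + 1))
              (T2RecAt d Lc (toSite r) cE cVH cΛ cE₂ cB ((8 * (M : ℝ) ^ 2)⁻¹ • wsym22 M) vh₂S (mixFFAt (toSite r) Lc) (0 + 1)))
            - lin4 (cE₂ * (Lc : ℝ) ^ (2 * (d + 1))) (unitK (sfStep Lc 0) (smStep d Lc 0) (KInvStep (d := d) Lc 0)) Lc
              (unitS₂ (sfStep Lc 0) (smStep d Lc 0)
                (T2RecAt d Lc (toSite r) cE cVH cΛ cE₂ cB ((8 * (M : ℝ) ^ 2)⁻¹ • wsym22 M) vh₂S (mixFFAt (toSite r) Lc) 0))) κ κ' (Sum.inl κ₁) (Sum.inl κ₂)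
        + zmode Lc ((unitS₂ (sfStep Lc (0 + 1)) (smStep d Lc (0 + 1))
              (T2RecAt d Lc (toSite r) cE cVH cΛ cE₂ cB ((8 * (M : ℝ) ^ 2)⁻¹ • wsym22 M) vh₂S (mixFFAt (toSite r) Lc) (0 + 1)))
            - lin4 (cE₂ * (Lc : ℝ) ^ (2 * (d + 1))) (unitK (sfStep Lc 0) (smStep d Lc 0) (KInvStep (d := d) Lc 0)) Lc
              (unitS₂ (sfStep Lc 0) (smStep d Lc 0)
                (T2RecAt d Lc (toSite r) cE cVH cΛ cE₂ cB ((8 * (M : ℝ) ^ 2)⁻¹ • wsym22 M) vh₂S (mixFFAt (toSite r) Lc) 0))) κ' κ (Sum.inl κ₁) (Sum.inl κ₂)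
      = 0 :=
  (zsymMember_succ_eq_iff_rowC hLc hr cE cVH cΛ cE₂ cB ((8 * (M : ℝ) ^ 2)⁻¹ • wsym22 M) hB hBt hcE₂ 0 κ κ' κ₁ κ₂).2
    (zmodeSym_member_one_eq_member_zero hd hLc hr hM cE cVH cΛ cE₂ cB hcE hcE₂ hBff hBmm hB hBt κ κ' κ₁ κ₂)

end Summit.QuantumFields.BalabanUV.Beta.GAN24.RowCLevelZero

end
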